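import Summits.QuantumFields.YangMills.Theorems.UnitScaleTiltFluctuationComparisonRegPrRepAtHeightsLowerRow
import Summits.QuantumFields.YangMills.Theorems.AlphaInputsT3ACv3Data
import HarnessLib

/-!
# Crux `FluctuationComparisonRegPrL` (stmt-QuantumFields-19935), v3 re-base: conjunct (A) `RepAtHeights` FOR AN ARBITRARY FAMILY OF v3 PACKAGES — part 1
# (`AlphaInputsT3AC.dataOfV3 p π`: the datum of a GIVEN family `p : ∀ K, PkgAtV3 F 𝔠 γ hγ hγ1 K`; the choice datum `OfV3At.dataT3v3` is its instance by `rfl`)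
# (support file `--supports stmt-QuantumFields-19935`; FINDING F-g4-1 of this seat)

Fleet seat `ym-ust-19201-p2` (gen 4, v5j pen).  WHY A FAMILY-GENERIC EDITION.  `OfV3At.dataT3v3` is assembled from the per-`K` packages `OfV3At.pkgAtV3 … K`, each a
`Classical.choice` from the non-empty type of admissible v3 packages of run `K` — independently for every `K`.  Rows that hold for EVERY admissible package (all of
conjunct (A)'s inputs) transfer to the chosen one; but a CROSS-`K` row (conjuncts (B)∧(C): `PolymerCauchyMinAtT` compares run `K+1` with run `K`) stated about two
independent choices is provable only if it holds for every PAIR of admissible packages, which the booked slack of the step rows forbids (FINDING F-g4-1: admissible top-level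
activities carry a `K`-independent relative freedom at fixed height, the two-run budget decays like `L^{−a(K−n)}`).  The honest typing of (B)∧(C) therefore quantifies an
admissible FAMILY `p : ∀ K, PkgAtV3 …` existentially and reads the datum `dataOfV3 p π` of THAT family; (A) must then be available for every admissible family — which is
what this file and its part 2 prove (the proofs of `…RepAtHeightsV3Base`/`…RepAtHeightsV3`, p511491/p512521, verbatim with `h.pkgAtV3 hc γ hγ hγ1 K ↦ p K`; ★alpha-1's
`PkgAtV3` API is already family-generic).
* §0 `AlphaInputsT3AC.dataOfV3 p π` (DEFINITION: `dataT3v3`'s field table over the given family) + `OfV3At.dataT3v3_eq_dataOfV3` (`rfl`) + the twins the chain reads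
  (`dataOfV3_{mainTermIsAction, uminTriv, rmSize, Ecst_eq, chi_eq, chi_eq_one_of_plaqSmall}`, ★alpha-1's proofs over `p K`);
* §1–§4 `dataOfV3_{baseTrivAt, trivExpIntegrable, mainTermAtHeights, oneStepLowerTrivAt}` — `mainTermAtHeights` under `hp : ∀ K, (p K).a₀ = a₀ ∧ (p K).a₁ = a₁`.
Nothing of Bałaban's is asserted; CONDITIONAL only on the family `p` (data carrying its rows).

References: T. Bałaban, CMP 102 (1985) 255–275 [Balaban1985UV3] ((1)–(2) p.256, (37) p.265, (41)–(42) p.266, (47) p.267, (55)–(62) pp.269–271, p.272);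
CMP 102 (1985) 277–309 [Balaban1985Variational] ((2), (6) p.278, Thm 1 (8) p.279).
-/

set_option autoImplicit false

noncomputable section

namespace Summit.QuantumFields.YangMills.Theorems

open MeasureTheory Filter
open Literature.MathematicalPhysics.QuantumFieldTheory.Balaban1983to89
open Literature.MathematicalPhysics.QuantumFieldTheory.Balaban1983to89.AveragingRT (rnTransport)
open Literature.MathematicalPhysics.QuantumFieldTheory.Balaban1983to89.B10
open Literature.MathematicalPhysics.QuantumFieldTheory.Balaban1983to89.B10SectAGathering
open Literature.MathematicalPhysics.QuantumFieldTheory.Balaban1983to89.T3ContinuumYM3Torus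
open Literature.MathematicalPhysics.QuantumFieldTheory.Balaban1983to89.T3UnitLawDensityEML (ℰp rt)
open Literature.MathematicalPhysics.QuantumFieldTheory.Balaban1983to89.T3UnitScaleTilt (θBal)
open Literature.MathematicalPhysics.QuantumFieldTheory.Balaban1983to89.T3LevelShift (fieldShift fieldShift_refl)
open Literature.MathematicalPhysics.QuantumFieldTheory.Balaban1983to89.T3PrintedRegularMinimiser
open Literature.MathematicalPhysics.QuantumFieldTheory.Balaban1983to89.T3AlphaInputsAC
open Literature.MathematicalPhysics.QuantumFieldTheory.Balaban1983to89.T3AlphaInputsACTrivEnvelope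
open Literature.MathematicalPhysics.QuantumFieldTheory.Balaban1983to89.Missing (boltzmann)
open Literature.MathematicalPhysics.QuantumFieldTheory.Balaban1985CMP102
open Literature.MathematicalPhysics.QuantumFieldTheory.Balaban1985CMP102.Setting
open Summit.QuantumFields.Balaban3D.Carriers
open Summit.QuantumFields.Balaban3D.Proofs.Primitives
open Summit.QuantumFields.Balaban3D.Proofs.TowerAC
open Summit.QuantumFields.Balaban3D.Proofs.StandardAC
open Summit.QuantumFields.Balaban3D.Proofs.InputsAC
open Summit.QuantumFields.Balaban3D.Proofs.TowerFactsAC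
open Summit.QuantumFields.Balaban3D.Proofs.Bound55AC
open Summit.QuantumFields.Balaban3D.Proofs.Thm2AC
open Summit.QuantumFields.Balaban3D.Proofs (Bound55Std.measurable_actionEta Bound55Std.actionEta_nonneg)
open Summit.QuantumFields.YangMills.Theorems.LogComparisonRepAtHeights
open Summit.QuantumFields.YangMills.Theorems.AlphaV3AC (stepResidualsV3_of_alpha)

variable {F : T3Family} {𝔠 : AlphaConsts F.L (suGroupModel 2).N} {γ : ℝ} {hγ : 0 < γ} {hγ1 : γ ≤ (min 𝔠.gamma0 1) ^ 2}
  (p : ∀ K, AlphaInputsT3AC.PkgAtV3 F 𝔠 γ hγ hγ1 K) (π : AlphaInputsT3AC.PolymerT3 F)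

/-! ## §0 The datum of a given family of v3 packages, and the twins the (A) chain reads -/

/-- **THE DATUM OF A GIVEN FAMILY OF v3 PACKAGES**: `OfV3At.dataT3v3`'s field table VERBATIM with the chosen record `h.pkgAtV3 hc γ hγ hγ1 K` replaced by the member `p K` of an
ARBITRARY family `p : ∀ K, PkgAtV3 F 𝔠 γ hγ hγ1 K` (histories/regions the lane's, `Adm := ChargedT3`, `LF := Σ_h wtP·e^Φ` with the record's windowed pinned weights, `Umin`,
`mainT`, `Pint`, `Zterm`, `χ`, `Estep`, `Rm` the AC tower's, `Ecst K j := E_j − E`, polymer fields the parameter `π`).  A DEFINITION; nothing asserted.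
[cite: Balaban1985UV3, (38)–(43) p.266 and (47) p.267] -/
def AlphaInputsT3AC.dataOfV3 : AlphaDataT3 F γ where
  Hist := fun K j => Hist (F.P K) j
  triv := fun K j => Hist.triv (F.P K) j
  Ω := fun K j hh i => Omega 𝔠.lane.carrier.M₁
    (rcolOf (T3Scales F γ hγ (hγ1.trans (sq_min_one_le _ 𝔠.gamma0_pos)) K) 𝔠.lane.carrier) j hh i
  Adm := fun K j hh W => ChargedT3 F γ 𝔠.b₀ 𝔠.p₀ (avgWindowFactor F.L) K 𝔠.lane.carrier.M₁
    (rcolOf (T3Scales F γ hγ (hγ1.trans (sq_min_one_le _ 𝔠.gamma0_pos)) K) 𝔠.lane.carrier) j hh W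
  LF := fun K j W Φ => ∑ r : Hist (F.P K) j, (p K).wtP j r W * Real.exp (Φ r)
  Umin := fun K j hh W => (p K).UkH j hh W
  mainT := fun K j hh W => (p K).T.mainT j hh W
  Pint := fun K j hh W => (p K).T.Pint j hh W
  Loc := π.Loc
  Pterm := π.Pterm
  enl := π.enl
  treeLen := π.treeLen
  Zterm := fun K j hh => (p K).T.Zterm j hh
  χ := fun K j W => (p K).T.χ j W
  Estep := fun K i => (p K).T.Estep i
  Ecst := fun K j => (p K).T.Ecst j - (p K).E
  Rm := fun K j => (p K).T.Rm j

/-- **THE CHOICE DATUM IS THE INSTANCE AT THE CHOSEN FAMILY** (definitional). [cite: Balaban1985UV3, (38)–(43) p.266] -/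
theorem AlphaInputsT3AC.OfV3At.dataT3v3_eq_dataOfV3 {a₀ a₁ : ℝ} (h : AlphaInputsT3AC.OfV3At F 𝔠 a₀ a₁)
    (hc : 0 < a₀ ∧ 0 < a₁ ∧ 𝔠.B₃ * a₁ ≤ a₀) (π : AlphaInputsT3AC.PolymerT3 F) :
    h.dataT3v3 hc γ hγ hγ1 π = AlphaInputsT3AC.dataOfV3 (fun K => h.pkgAtV3 hc γ hγ hγ1 K) π :=
  rfl

/-- **`MainTermIsAction`** for the family datum — EXACT (`PkgAtV3.mainT_eq`). [cite: Balaban1985UV3, (5) p.256 and (41) p.266] -/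
theorem AlphaInputsT3AC.dataOfV3_mainTermIsAction : MainTermIsAction (AlphaInputsT3AC.dataOfV3 p π) :=
  fun K j hh W => (p K).mainT_eq j hh W

/-- **THE `UminTrivIsRegMinimiser` CLAUSES AT A HEIGHT `n < K` for the family datum — from r1** under the [7] bookkeeping against the member's OWN constants
`θBal(n) ≤ (p K).a₁`, `B₃θBal(n) ≤ ε₀ ≤ (p K).a₀`. [cite: Balaban1985Variational, Thm 1 (8) p.279 and Prop 7 p.299] -/
theorem AlphaInputsT3AC.dataOfV3_uminTriv (K n : ℕ) (hnK : n < K) (ε₀ : ℝ)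
    (ha₁ : θBal F.L γ 𝔠.b₀ 𝔠.p₀ n ≤ (p K).a₁) (hlo : 𝔠.B₃ * θBal F.L γ 𝔠.b₀ 𝔠.p₀ n ≤ ε₀) (hhi : ε₀ ≤ (p K).a₀)
    (V : GaugeField (F.P n) 0 (Matrix.specialUnitaryGroup (Fin 2) ℂ)) (hV : PlaqSmall (θBal F.L γ 𝔠.b₀ 𝔠.p₀ n) V) :
    (AlphaInputsT3AC.dataOfV3 p π).Umin K (K - n) ((AlphaInputsT3AC.dataOfV3 p π).triv K (K - n))
        (fieldShift (F.sitesPerDir_eq (m := F.m) (K := K) (j := K - n) (m' := F.m) (K' := n) (j' := 0) (by omega)) V) ∈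
      regFibrePr F n K hnK.le ε₀ V ∧
    wilsonAction4 ((AlphaInputsT3AC.dataOfV3 p π).Umin K (K - n) ((AlphaInputsT3AC.dataOfV3 p π).triv K (K - n))
        (fieldShift (F.sitesPerDir_eq (m := F.m) (K := K) (j := K - n) (m' := F.m) (K' := n) (j' := 0) (by omega)) V)) =
      minActionRegPr F n K hnK.le ε₀ V := by
  have hθ : 0 < θBal F.L γ 𝔠.b₀ 𝔠.p₀ n := by
    have := (p K).θBal_pos (K - n) (by omega)
    rwa [show K - (K - n) = n by omega] at this
  exact ⟨(p K).uminTriv_mem_regFibrePr hnK hθ ha₁ hlo hhi V hV, (p K).uminTriv_action_eq hnK hθ ha₁ hlo hhi V hV⟩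

/-- **The `EcstBook` identity** for the family datum: `Ecst K j = −Σ_{i<j} Estep K i`, `j ≤ K`. [cite: Balaban1985UV3, (62) p.271 and (64) p.273] -/
theorem AlphaInputsT3AC.dataOfV3_Ecst_eq (K j : ℕ) (hj : j ≤ K) :
    (AlphaInputsT3AC.dataOfV3 p π).Ecst K j = -∑ i ∈ Finset.range j, (AlphaInputsT3AC.dataOfV3 p π).Estep K i :=
  (p K).Ecst_sub_E_eq j hj

/-- **`RmSize`** for the family datum with `C = r⋆γ^{3+κ₀}`, `q = L^{−κ₀}` (`PkgAtV3.Rm_eq`). [cite: Balaban1985UV3, (41) p.266 and (5) p.256] -/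
theorem AlphaInputsT3AC.dataOfV3_rmSize :
    RmSize (AlphaInputsT3AC.dataOfV3 p π) (𝔠.stepConsts.rstar * γ ^ (3 + 𝔠.κ₀)) (((F.L : ℝ)⁻¹) ^ 𝔠.κ₀) := by
  have hL1 : (1 : ℝ) < F.L := by exact_mod_cast F.hL.2
  have hLi : (0 : ℝ) ≤ (F.L : ℝ)⁻¹ := inv_nonneg.mpr (zero_lt_one.trans hL1).le
  have hq0 : 0 ≤ ((F.L : ℝ)⁻¹) ^ 𝔠.κ₀ := Real.rpow_nonneg hLi _
  refine ⟨hq0, Real.rpow_lt_one hLi (inv_lt_one_of_one_lt₀ hL1) 𝔠.κ₀_pos, fun K j hj => ?_⟩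
  have heq : (AlphaInputsT3AC.dataOfV3 p π).Rm K j = 𝔠.stepConsts.rstar * γ ^ (3 + 𝔠.κ₀) *
      (∑ i ∈ Finset.range j, (((F.L : ℝ)⁻¹) ^ 𝔠.κ₀) ^ (K - i)) * (2 * (F.L : ℝ) ^ F.m) ^ 3 :=
    (p K).Rm_eq j hj
  refine ⟨?_, heq.le⟩
  rw [heq]
  have h3 : 0 ≤ ∑ i ∈ Finset.range j, (((F.L : ℝ)⁻¹) ^ 𝔠.κ₀) ^ (K - i) := Finset.sum_nonneg fun i _ => pow_nonneg hq0 _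
  have h4 : 0 ≤ (2 * (F.L : ℝ) ^ F.m) ^ 3 := by positivity
  exact mul_nonneg (mul_nonneg (mul_nonneg 𝔠.stepConsts.rstar_nonneg (Real.rpow_nonneg hγ.le _)) h3) h4

/-- **`χ_j` IS THE INDICATOR OF THE ROUTE'S WINDOW** for the family datum, `j ≤ K`. [cite: Balaban1985UV3, (47) p.267] -/
theorem AlphaInputsT3AC.dataOfV3_chi_eq (K j : ℕ) (hj : j ≤ K) (W : GaugeField (F.P K) j (Matrix.specialUnitaryGroup (Fin 2) ℂ)) :
    (AlphaInputsT3AC.dataOfV3 p π).χ K j W = chiSmall Set.univ (θBal F.L γ 𝔠.b₀ 𝔠.p₀ (K - j)) W := by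
  rw [← (p K).eps1_eq j hj]
  rfl

/-- `χ_j(W) = 1` on the window, family datum. [cite: Balaban1985UV3, (47) p.267] -/
theorem AlphaInputsT3AC.dataOfV3_chi_eq_one_of_plaqSmall (K j : ℕ) (hj : j ≤ K)
    (W : GaugeField (F.P K) j (Matrix.specialUnitaryGroup (Fin 2) ℂ)) (hW : PlaqSmall (θBal F.L γ 𝔠.b₀ 𝔠.p₀ (K - j)) W) :
    (AlphaInputsT3AC.dataOfV3 p π).χ K j W = 1 := by
  rw [AlphaInputsT3AC.dataOfV3_chi_eq p π K j hj W]
  unfold chiSmall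
  rw [if_pos (show PlaqSmallOn Set.univ (θBal F.L γ 𝔠.b₀ 𝔠.p₀ (K - j)) W from fun q _ => hW q)]

/-! ## §1 Level `0` of every run and the base row -/

/-- `U_0(triv, W) = W` for the v3 datum (the package's `hU0`). [cite: Balaban1985UV3, (1) p.256] -/
theorem AlphaInputsT3AC.dataOfV3_umin_zero (K : ℕ) (W : GaugeField (F.P K) 0 (Matrix.specialUnitaryGroup (Fin 2) ℂ)) :
    (AlphaInputsT3AC.dataOfV3 p π).Umin K 0 ((AlphaInputsT3AC.dataOfV3 p π).triv K 0) W = W :=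
  (p K).hU0 W

/-- `Pint_0 ≡ 0` for the v3 datum (`pintOfSeries` at level `0`). [cite: Balaban1985UV3, (1) p.256] -/
theorem AlphaInputsT3AC.dataOfV3_pint_zero (K : ℕ) (hh : (AlphaInputsT3AC.dataOfV3 p π).Hist K 0)
    (W : GaugeField (F.P K) 0 (Matrix.specialUnitaryGroup (Fin 2) ℂ)) :
    (AlphaInputsT3AC.dataOfV3 p π).Pint K 0 hh W = 0 :=
  rfl

/-- `mainT_0(triv, W) = β_K·A(W)` for the v3 datum (`MainTermIsAction` + `U_0 = id`). [cite: Balaban1985UV3, (1) p.256 and (5) p.256] -/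
theorem AlphaInputsT3AC.dataOfV3_mainT_triv_zero (K : ℕ) (W : GaugeField (F.P K) 0 (Matrix.specialUnitaryGroup (Fin 2) ℂ)) :
    (AlphaInputsT3AC.dataOfV3 p π).mainT K 0 ((AlphaInputsT3AC.dataOfV3 p π).triv K 0) W = (F.scheme ℰp γ).β K * wilsonAction4 W := by
  rw [AlphaInputsT3AC.dataOfV3_mainTermIsAction p π K 0 _ W, AlphaInputsT3AC.dataOfV3_umin_zero p π K W]

/-- `Ecst K 0 = 0` for the v3 datum (route normalisation). [cite: Balaban1985UV3, (62) p.271 and (64) p.273] -/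
theorem AlphaInputsT3AC.dataOfV3_Ecst_zero (K : ℕ) : (AlphaInputsT3AC.dataOfV3 p π).Ecst K 0 = 0 := by
  rw [AlphaInputsT3AC.dataOfV3_Ecst_eq p π K 0 (Nat.zero_le K), Finset.range_zero, Finset.sum_empty, neg_zero]

/-- **`BaseTrivAt` FOR THE v3 DATUM** at every cut-off. [cite: Balaban1985UV3, (1) p.256] -/
theorem AlphaInputsT3AC.dataOfV3_baseTrivAt (K : ℕ) : BaseTrivAt (AlphaInputsT3AC.dataOfV3 p π) 𝔠.b₀ 𝔠.p₀ K := by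
  refine ae_of_all _ fun W _ => ?_
  have hR : 0 ≤ (AlphaInputsT3AC.dataOfV3 p π).Rm K 0 := Rm_nonneg (AlphaInputsT3AC.dataOfV3_rmSize p π) (Nat.zero_le K)
  rw [lowerTriv_eq_exp, upperTriv_eq_exp, AlphaInputsT3AC.dataOfV3_mainT_triv_zero p π K W, AlphaInputsT3AC.dataOfV3_pint_zero p π K _ W,
    AlphaInputsT3AC.dataOfV3_Ecst_zero p π K]
  unfold boltzmann
  constructor
  · apply Real.exp_le_exp.mpr
    linarith
  · apply Real.exp_le_exp.mpr
    linarith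

/-! ## §2 Integrability of the trivial exponentials -/

/-- **`TrivExpIntegrable` FOR THE v3 DATUM**: `e^{−mainT_j(triv) + Pint_j(triv)}` is integrable at every level `j ≤ K` (data rows `PkgAtV3.measurable_UkH`,
`measurable_Pint`, `Pint_le` at every `j ≤ K`; `mainT ≥ 0`). [cite: Balaban1985UV3, (41) p.266] -/
theorem AlphaInputsT3AC.dataOfV3_trivExpIntegrable : TrivExpIntegrable (AlphaInputsT3AC.dataOfV3 p π) := by
  intro K j hj
  have hU := (p K).measurable_UkH j hj (Hist.triv (F.P K) j)
  have hPm := (p K).measurable_Pint j hj (Hist.triv (F.P K) j)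
  have hPb := fun U => (p K).Pint_le j hj (Hist.triv (F.P K) j) U
  show Integrable (fun W => Real.exp (-((p K).T.mainT j (Hist.triv (F.P K) j) W) +
    (p K).T.Pint j (Hist.triv (F.P K) j) W)) _
  have hmain : ∀ W : GaugeField (F.P K) j (Matrix.specialUnitaryGroup (Fin 2) ℂ),
      (p K).T.mainT j (Hist.triv (F.P K) j) W =
        ((T3Scales F γ hγ (hγ1.trans (sq_min_one_le _ 𝔠.gamma0_pos)) K).gk j)⁻¹ ^ 2 *
          (T3Scales F γ hγ (hγ1.trans (sq_min_one_le _ 𝔠.gamma0_pos)) K).actionEta j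
            ((p K).UkH j (Hist.triv (F.P K) j) W) := fun _ => rfl
  have h1 := Balaban3D.Proofs.Transport48.integrable_weight_mul_exp (P := F.P K) (G := Matrix.specialUnitaryGroup (Fin 2) ℂ)
    (m := fun _ => (1 : ℝ)) measurable_const (fun _ => zero_le_one) (fun _ => le_rfl)
    (F := fun W => -((p K).T.mainT j (Hist.triv (F.P K) j) W) +
      (p K).T.Pint j (Hist.triv (F.P K) j) W) ?_ (c := (p K).𝔄.cP j) ?_
  · exact h1.congr (ae_of_all _ fun W => one_mul _)
  · simp_rw [hmain]
    exact (measurable_const.mul ((Bound55Std.measurable_actionEta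
      (S := T3Scales F γ hγ (hγ1.trans (sq_min_one_le _ 𝔠.gamma0_pos)) K) j).comp hU)).neg.add hPm
  · intro W
    have h0 : 0 ≤ (p K).T.mainT j (Hist.triv (F.P K) j) W := by
      rw [hmain]
      exact mul_nonneg (sq_nonneg _) (Bound55Std.actionEta_nonneg (S := T3Scales F γ hγ (hγ1.trans (sq_min_one_le _ 𝔠.gamma0_pos)) K) j _)
    have h2 : (p K).T.Pint j (Hist.triv (F.P K) j) W ≤ (p K).𝔄.cP j := hPb W
    linarith

/-! ## §3 The main term at the heights, including the cut-off height `n = K` -/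

/-- At the cut-off height the composite minimiser at the trivial history IS the datum (index bookkeeping + `hU0`). [cite: Balaban1985UV3, (1) p.256] -/
theorem AlphaInputsT3AC.dataOfV3_umin_sub_self (K : ℕ) (V : GaugeField (F.P K) 0 (Matrix.specialUnitaryGroup (Fin 2) ℂ))
    (e : (F.PP F.m K).sitesPerDir (K - K) = (F.PP F.m K).sitesPerDir 0) :
    (AlphaInputsT3AC.dataOfV3 p π).Umin K (K - K) ((AlphaInputsT3AC.dataOfV3 p π).triv K (K - K)) (fieldShift e V) = V := by
  have aux : ∀ (j : ℕ) (hj : j = 0) (e' : (F.PP F.m K).sitesPerDir j = (F.PP F.m K).sitesPerDir 0),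
      (AlphaInputsT3AC.dataOfV3 p π).Umin K j ((AlphaInputsT3AC.dataOfV3 p π).triv K j) (fieldShift e' V) = V := by
    intro j hj e'
    subst hj
    rw [fieldShift_refl]
    exact AlphaInputsT3AC.dataOfV3_umin_zero p π K V
  exact aux (K - K) (Nat.sub_self K) e

/-- **`MainTermAtHeights` FOR THE v3 DATUM** under the adapter's thresholds: for `n < K` by r1 (`dataT3v3_uminTriv`) and `MainTermIsAction`; for `n = K` the fibre
is the datum itself (`minActionRegPr_self_of_plaqSmall`, p502074). [cite: Balaban1985UV3, (42) p.266; Balaban1985Variational, Thm 1 (8) p.279] -/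
theorem AlphaInputsT3AC.dataOfV3_mainTermAtHeights {a₀ a₁ : ℝ} (hp : ∀ K, (p K).a₀ = a₀ ∧ (p K).a₁ = a₁)
    (ε₀ : ℝ) (hε : 0 < ε₀) (hhi : ε₀ ≤ a₀)
    (ha₁ : ∀ n, θBal F.L γ 𝔠.b₀ 𝔠.p₀ n ≤ a₁) (hlo : ∀ n, 𝔠.B₃ * θBal F.L γ 𝔠.b₀ 𝔠.p₀ n ≤ ε₀)
    (h4 : ∀ n, 4 * θBal F.L γ 𝔠.b₀ 𝔠.p₀ n < ε₀) :
    MainTermAtHeights (AlphaInputsT3AC.dataOfV3 p π) 𝔠.b₀ 𝔠.p₀ ε₀ := by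
  intro K n hn V hV
  rw [AlphaInputsT3AC.dataOfV3_mainTermIsAction p π]
  congr 1
  rcases Nat.lt_or_eq_of_le hn with hlt | heq
  · exact (AlphaInputsT3AC.dataOfV3_uminTriv p π K n hlt ε₀ ((hp K).2.symm ▸ ha₁ n) (hlo n) ((hp K).1.symm ▸ hhi) V hV).2
  · subst heq
    rw [AlphaInputsT3AC.dataOfV3_umin_sub_self p π n V]
    exact (minActionRegPr_self_of_plaqSmall (F := F) hn hε V hV (h4 n)).symm

/-! ## §4 The lower one-step trivial envelope of the v3 datum from the v3 (α) rows -/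

/-- The window dictionary as an indicator identity for the v3 datum's characteristic function. [cite: Balaban1985UV3, (47) p.267] -/
theorem AlphaInputsT3AC.dataOfV3_chi_mul_eq_indicator (K j : ℕ) (hj : j ≤ K)
    (f : GaugeField (F.P K) j (Matrix.specialUnitaryGroup (Fin 2) ℂ) → ℝ) (U : GaugeField (F.P K) j (Matrix.specialUnitaryGroup (Fin 2) ℂ)) :
    (AlphaInputsT3AC.dataOfV3 p π).χ K j U * f U =
      {W' : GaugeField (F.P K) j (Matrix.specialUnitaryGroup (Fin 2) ℂ) | PlaqSmall (θBal F.L γ 𝔠.b₀ 𝔠.p₀ (K - j)) W'}.indicator f U := by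
  rw [AlphaInputsT3AC.dataOfV3_chi_eq p π K j hj U]
  unfold chiSmall
  by_cases hU : PlaqSmall (θBal F.L γ 𝔠.b₀ 𝔠.p₀ (K - j)) U
  · rw [if_pos (show PlaqSmallOn Set.univ (θBal F.L γ 𝔠.b₀ 𝔠.p₀ (K - j)) U from fun q _ => hU q), one_mul,
      Set.indicator_of_mem (show U ∈ {W' | PlaqSmall (θBal F.L γ 𝔠.b₀ 𝔠.p₀ (K - j)) W'} from hU)]
  · rw [if_neg (fun hs : PlaqSmallOn Set.univ (θBal F.L γ 𝔠.b₀ 𝔠.p₀ (K - j)) U => hU fun q => hs q (Set.mem_univ q)), zero_mul,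
      Set.indicator_of_notMem (show U ∉ {W' | PlaqSmall (θBal F.L γ 𝔠.b₀ 𝔠.p₀ (K - j)) W'} from hU)]

/-- **THE LOWER ONE-STEP TRIVIAL ENVELOPE OF THE v3 DATUM — PROVED FROM THE v3 (α) ROWS**: for every run `K` and step `k < K`,
`OneStepLowerTrivAt (dataT3v3 …) 𝔠.b₀ 𝔠.p₀ K k` — the v3 step row `fibre57Low`, the lower gathering (p503151 `ineq47_exponent_succ_le`) over the eight residual leaves
`stepResidualsV3_of_alpha` + `starCount_piecesAC` + the series run identities `pintSucc_seriesAC`/`estep62_seriesAC`/`rmSucc_piecesAC`, homogeneity of the transport for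
`e^{E}`, and the window dictionary. [cite: Balaban1985UV3, (37) p.265, (47) p.267 and p.272] -/
theorem AlphaInputsT3AC.dataOfV3_oneStepLowerTrivAt (K k : ℕ) (hk : k + 1 ≤ K) :
    OneStepLowerTrivAt (AlphaInputsT3AC.dataOfV3 p π) 𝔠.b₀ 𝔠.p₀ K k hk := by
  -- the package's data of run `K`, its v3 step row at `k`, the residual leaves, the gathering
  have hle := T3Scales_window F 𝔠 γ hγ hγ1 K
  have st := (p K).run.steps k hk
  have R := stepResidualsV3_of_alpha hle k hk st
  have hgath := fun U => ineq47_exponent_succ_le (piecesAC 𝔠.lane (p K).X (p K).𝔖 k) hk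
    R.cumulantLower R.repr33_60 R.vacuumWhole R.decomp35_61 R.norm35
    (starCount_piecesAC 𝔠.lane (p K).X (p K).𝔖 k hk) R.oldOutside
    (((p K).X.toTowerBase 𝔠.lane.carrier).pintSucc_seriesAC _ _ k)
    (((p K).X.toTowerBase 𝔠.lane.carrier).estep62_seriesAC _ _ k)
    ((rmSucc_piecesAC 𝔠.lane (p K).X (p K).𝔖 k).mono
      (by have := le_max_right 𝔠.lane.sc.C₁ 𝔠.lane.sc.C₁'; linarith)) U
  have h57 := st.fibre57Low
  have hint47 := hint47_stdAC (p K).X 𝔠.lane.carrier (p K).𝔖 (fun _ => True) k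
    (st.hU _) (st.hPm _) ((p K).𝔄.cP k) (st.hPb _)
  -- abbreviations in the tower's letters
  set T : TowerRun := (p K).T with hT
  set E : ℝ := (p K).E with hE
  set P := piecesAC 𝔠.lane (p K).X (p K).𝔖 k with hP
  -- the integrand of the right side of `Fibre57LowAC` and its non-negativity
  set f : GaugeField (F.P K) k (Matrix.specialUnitaryGroup (Fin 2) ℂ) → ℝ := fun U =>
    T.χ k U * Real.exp (-(T.mainT k (T.triv k) U) + T.Pint k (T.triv k) U - T.Ecst k - T.Rm k) with hf
  have hf0 : ∀ U, 0 ≤ f U := fun U => mul_nonneg (T.χ_nonneg k U) (Real.exp_pos _).le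
  have hfi : Integrable f (fieldMeasure (F.P K) k (Matrix.specialUnitaryGroup (Fin 2) ℂ)) := hint47
  -- the transport of the route: `rt F K k` IS `rnTransport` over the pinned averaging `(p.X).av k = blockAvg ℰp`
  have hkm : k + 1 ≤ F.m + K := by omega
  have hav : ((p K).X).av k = BlockAveraging.blockAvg (P := F.P K) (j := k) ℰp := avT3_of_le F K hkm
  have hrtT : ∀ g : GaugeField (F.P K) k (Matrix.specialUnitaryGroup (Fin 2) ℂ) → ℝ,
      (rt F K k hkm).T g = rnTransport (((p K).X).av k).avg g := fun g => by
    rw [hav]; rfl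
  -- the restricted lower envelope of level `k` IS `e^{E}·f`
  have hind : {W' : GaugeField (F.P K) k (Matrix.specialUnitaryGroup (Fin 2) ℂ) | PlaqSmall (θBal F.L γ 𝔠.b₀ 𝔠.p₀ (K - k)) W'}.indicator
      (lowerTriv (AlphaInputsT3AC.dataOfV3 p π) K k) = fun U => Real.exp E * f U := by
    funext U
    rw [← AlphaInputsT3AC.dataOfV3_chi_mul_eq_indicator p π K k (by omega) _ U, lowerTriv_eq_exp]
    show T.χ k U * Real.exp ((-(T.mainT k (T.triv k) U) + T.Pint k (T.triv k) U - (T.Ecst k - E)) - T.Rm k) =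
      Real.exp E * (T.χ k U * Real.exp (-(T.mainT k (T.triv k) U) + T.Pint k (T.triv k) U - T.Ecst k - T.Rm k))
    rw [show (-(T.mainT k (T.triv k) U) + T.Pint k (T.triv k) U - (T.Ecst k - E)) - T.Rm k =
        E + (-(T.mainT k (T.triv k) U) + T.Pint k (T.triv k) U - T.Ecst k - T.Rm k) by ring, Real.exp_add]
    ring
  -- homogeneity of the transport under the constant `e^{E}`
  have hhom := rnTransport_const_mul_ae (((p K).X).av k).avg f hf0 hfi (Real.exp_nonneg E)
  -- the goal
  show ∀ᵐ W ∂fieldMeasure (F.P K) (k + 1) (Matrix.specialUnitaryGroup (Fin 2) ℂ),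
    PlaqSmall (θBal F.L γ 𝔠.b₀ 𝔠.p₀ (K - (k + 1))) W →
      lowerTriv (AlphaInputsT3AC.dataOfV3 p π) K (k + 1) W ≤
        (rt F K k hkm).T ({W' : GaugeField (F.P K) k (Matrix.specialUnitaryGroup (Fin 2) ℂ) |
          PlaqSmall (θBal F.L γ 𝔠.b₀ 𝔠.p₀ (K - k)) W'}.indicator (lowerTriv (AlphaInputsT3AC.dataOfV3 p π) K k)) W
  rw [hind, hrtT]
  filter_upwards [h57, hhom] with W h57W hhomW
  intro hWs
  have hχ1 : T.χ (k + 1) W = 1 := AlphaInputsT3AC.dataOfV3_chi_eq_one_of_plaqSmall p π K (k + 1) hk W hWs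
  have hexp : lowerTriv (AlphaInputsT3AC.dataOfV3 p π) K (k + 1) W =
      Real.exp E * Real.exp (-(T.mainT (k + 1) (T.triv (k + 1)) W) + T.Pint (k + 1) (T.triv (k + 1)) W - T.Ecst (k + 1) - T.Rm (k + 1)) := by
    rw [lowerTriv_eq_exp]
    show Real.exp ((-(T.mainT (k + 1) (T.triv (k + 1)) W) + T.Pint (k + 1) (T.triv (k + 1)) W - (T.Ecst (k + 1) - E)) - T.Rm (k + 1)) = _
    rw [← Real.exp_add]
    congr 1
    ring
  have key : lowerTriv (AlphaInputsT3AC.dataOfV3 p π) K (k + 1) W ≤ Real.exp E * rnTransport (((p K).X).av k).avg f W := by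
    rw [hexp]
    refine mul_le_mul_of_nonneg_left ?_ (Real.exp_nonneg E)
    calc Real.exp (-(T.mainT (k + 1) (T.triv (k + 1)) W) + T.Pint (k + 1) (T.triv (k + 1)) W - T.Ecst (k + 1) - T.Rm (k + 1))
        ≤ Real.exp (-(T.mainT (k + 1) (T.triv (k + 1)) W) - T.Ecst k
            + (P.logσ₀ + P.dg * Real.log (T.g k)) * P.starB (T.triv (k + 1)) + P.logZU (T.triv (k + 1)) W
            + P.Pold (T.triv (k + 1)) W - T.Rm k + P.logFl (T.triv (k + 1)) W) := Real.exp_le_exp.mpr (hgath W)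
      _ = T.χ (k + 1) W * Real.exp (-(T.mainT (k + 1) (T.triv (k + 1)) W) - T.Ecst k
            + (P.logσ₀ + P.dg * Real.log (T.g k)) * P.starB (T.triv (k + 1)) + P.logZU (T.triv (k + 1)) W
            + P.Pold (T.triv (k + 1)) W - T.Rm k + P.logFl (T.triv (k + 1)) W) := by rw [hχ1, one_mul]
      _ ≤ rnTransport (((p K).X).av k).avg f W := h57W
  exact key.trans (le_of_eq hhomW.symm)

end Summit.QuantumFields.YangMills.Theorems

end
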